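import Mathlib.Algebra.Polynomial.Inductions
import Mathlib.RingTheory.Polynomial.Ideal
import Summits.ResolutionOfSingularities.ResolutionOfSingularities.Theorems.FrobeniusClosingPatchingRelPerfectDepthTaylorFlag
import Summits.ResolutionOfSingularities.ResolutionOfSingularities.Theorems.FrobeniusClosingPatchingRelPerfectDepthTaylorPolynomial
import Literature.AlgebraicGeometry.Resolution.IdealSheafLemmas
import HarnessLib

/-!
# Crux `PatchingRelPerfect` (stmt-ResolutionOfSingularities-16161), chain W5.2 — depth-`ℓ` programme beyond the graded case,
# GLUE G2: the abstract coefficient flag on an affine retraction pair is the ring-level flag, and on `B[t] ⊇ B` it is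
# the family of coefficient ideals (lead prover, gen 4; spec `FilteredGlueSpec` G2 of gen 3)

[OURS · L1 W5.2 · lead] Replaces the role of NO printed item; NOT a statement of the manuscript under review.

`…DepthTaylorFlag` (p507375) defines, for a retraction pair of schemes `k : W ⟶ V`, `r : V ⟶ W`, the Taylor shift
`taylorShift k r J = ((J ⊔ r^*(J|_W)) ⊓ ker k : ker k)` and the coefficient flag `coeffFlag k r a J = (taylorShift^a J)|_W`;
`…DepthTaylorPolynomial` (p508112) works with the coefficient ideals `coeffIdeal 𝔎 b ⊆ B` of an ideal `𝔎 ⊆ B[t]`. This file is the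
dictionary between the two:

* §1 ring level: `taylorShiftRing φk φr 𝔍 = ((𝔍 ⊔ φr(φk(𝔍))) ⊓ ker φk : ker φk)` for a retraction pair of RINGS `φk : R → A`,
  `φr : A → R`, its iterate and `coeffFlagRing φk φr a 𝔍 = φk(taylorShiftRing^a 𝔍)`; for the pair `(constantCoeff, C)` of
  `B[t] ⊇ B`: **`coeffIdeal_taylorShiftRing : coeffIdeal (taylorShiftRing 𝔎) b = coeffIdeal 𝔎 (b+1)`** («subtract the constant
  term, divide by `t`» shifts the coefficient flag by one) and **`coeffFlagRing_eq_coeffIdeal : coeffFlagRing constantCoeff C a 𝔎 =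
  coeffIdeal 𝔎 a`**; transport of the flag along ring isomorphisms compatible with the pair (`coeffFlagRing_map_of_comm`).
* §2 scheme ↔ ring: for `V`, `W` AFFINE and `ker k.appTop` finitely generated (e.g. `(t)`), the global sections of
  `taylorShift k r J`, `taylorShiftIter` and **`coeffFlag k r a J`** are `taylorShiftRing`, its iterate and **`coeffFlagRing`** of the
  global sections of `J` for the pair `(k.appTop, r.appTop)` (`ideal_top_coeffFlag`); hence on a trivialising chart `Γ(V) ≃ Γ(W)[t]`
  (`k.appTop = constantCoeff`, `r.appTop = C` after the identification) **`ideal_top_coeffFlag_eq_coeffIdeal`**: the abstract flag IS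
  the family of coefficient ideals.

With G1 (`…DepthBlowupPolynomialChart`: the chart of the blow-up along `V(𝔷) × {0}` is `(B[𝔷/z])[t′]`, `t = z t′`) and the transform
law `coeffIdeal_transform_eq` (p508112) this is the PROPAGATION of the abstract flag through a dictionary step, chartwise. Fact-free;
AI-written, weaker than expert review. G3 (the chain's retractions are Zariski-locally trivialisable in this sense, and stay so) is a
separate object.

References: H. Kawanoue, K. Matsuki, Adv. Stud. Pure Math. 70 (2016), §2 (idealistic filtrations) [KawanoueMatsuki2016];
U. Görtz, T. Wedhorn, *Algebraic Geometry I*, 2nd ed. (2020), (7.19)–(7.20), (4.11) [GortzWedhorn2020].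
-/

-- `Summit.<Summit>.<Sub>.Theorems` with `Sub = Summit` (single-conjunct summit, D-0017)
set_option linter.dupNamespace false

noncomputable section

open Polynomial CategoryTheory AlgebraicGeometry TopologicalSpace
open Literature.AlgebraicGeometry.Resolution

namespace Summit.ResolutionOfSingularities.ResolutionOfSingularities.Theorems

universe u

/-! ## §1 The ring-level Taylor shift and flag -/

namespace DepthGraded.Taylor

section RingPair

variable {R A : Type u} [CommRing R] [CommRing A] (φk : R →+* A) (φr : A →+* R)

/-- [OURS · L1 W5.2 · lead] **Ring-level Taylor shift** along a retraction pair of rings `φk : R → A` («restrict to `W`»),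
`φr : A → R` («pull back along `r`»): `((𝔍 ⊔ φr(φk(𝔍))·R) ⊓ ker φk : ker φk)` — subtract the constant term and divide by the
ideal of `W`. The global-sections form of `DepthGraded.taylorShift`. [cite: KawanoueMatsuki2016, §2] -/
def taylorShiftRing (𝔍 : Ideal R) : Ideal R :=
  ((𝔍 ⊔ (𝔍.map φk).map φr) ⊓ RingHom.ker φk).colon (RingHom.ker φk : Set R)

/-- [OURS · L1 W5.2 · lead] The `a`-fold ring-level Taylor shift. [cite: KawanoueMatsuki2016, §2] -/
def taylorShiftRingIter : ℕ → Ideal R → Ideal R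
  | 0, 𝔍 => 𝔍
  | a + 1, 𝔍 => taylorShiftRingIter a (taylorShiftRing φk φr 𝔍)

/-- [OURS · L1 W5.2 · lead] **Ring-level coefficient flag**: `φk` of the `a`-fold Taylor shift (the ideal of `A` generated by the
Taylor coefficients of orders `≤ a`). The global-sections form of `DepthGraded.coeffFlag`. [cite: KawanoueMatsuki2016, §2] -/
def coeffFlagRing (a : ℕ) (𝔍 : Ideal R) : Ideal A :=
  (taylorShiftRingIter φk φr a 𝔍).map φk

/-- Zero-fold shift. [folklore] -/
@[simp] theorem taylorShiftRingIter_zero (𝔍 : Ideal R) : taylorShiftRingIter φk φr 0 𝔍 = 𝔍 := rfl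

/-- Successor unfolding. [folklore] -/
theorem taylorShiftRingIter_succ (a : ℕ) (𝔍 : Ideal R) :
    taylorShiftRingIter φk φr (a + 1) 𝔍 = taylorShiftRingIter φk φr a (taylorShiftRing φk φr 𝔍) := rfl

end RingPair

/-! ### Transport along ring isomorphisms compatible with the pair -/

section Transport

variable {R A R' A' : Type u} [CommRing R] [CommRing A] [CommRing R'] [CommRing A']

/-- Colon ideals along a ring isomorphism. [folklore] -/
theorem map_colon_of_ringEquiv (e : R ≃+* R') (N P : Ideal R) :
    (N.colon (P : Set R)).map (e : R →+* R') =
      (N.map (e : R →+* R')).colon (P.map (e : R →+* R') : Set R') := by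
  ext y
  rw [Ideal.map_comap_of_equiv, Ideal.map_comap_of_equiv, Ideal.map_comap_of_equiv, Ideal.mem_comap,
    Submodule.mem_colon, Submodule.mem_colon]
  constructor
  · intro h p' hp'
    rw [SetLike.mem_coe, Ideal.mem_comap] at hp'
    rw [Ideal.mem_comap, smul_eq_mul, map_mul]
    exact h _ hp'
  · intro h p hp
    have h' := h (e p) (by rw [SetLike.mem_coe, Ideal.mem_comap, e.symm_apply_apply]; exact hp)
    rw [Ideal.mem_comap, smul_eq_mul, map_mul, e.symm_apply_apply] at h'
    exact h'

/-- Intersections along a ring isomorphism. [folklore] -/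
theorem map_inf_of_ringEquiv (e : R ≃+* R') (I J : Ideal R) :
    (I ⊓ J).map (e : R →+* R') = I.map (e : R →+* R') ⊓ J.map (e : R →+* R') := by
  rw [Ideal.map_comap_of_equiv, Ideal.map_comap_of_equiv, Ideal.map_comap_of_equiv, Ideal.comap_inf]

variable (φk : R →+* A) (φr : A →+* R) (φk' : R' →+* A') (φr' : A' →+* R') (eR : R ≃+* R') (eA : A ≃+* A')
  (hk : ∀ x, φk' (eR x) = eA (φk x)) (hr : ∀ a, φr' (eA a) = eR (φr a))

include hk in
/-- Kernels along a compatible pair of ring isomorphisms. [folklore] -/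
theorem ker_eq_map_of_comm : RingHom.ker φk' = (RingHom.ker φk).map (eR : R →+* R') := by
  ext y
  rw [Ideal.map_comap_of_equiv, Ideal.mem_comap, RingHom.mem_ker, RingHom.mem_ker]
  conv_lhs => rw [← eR.apply_symm_apply y, hk]
  rw [map_eq_zero_iff _ eA.injective]

include hk hr in
/-- **Transport of the ring-level Taylor shift** along ring isomorphisms `eR`, `eA` intertwining the two pairs.
[folklore] -/
theorem taylorShiftRing_map_of_comm (𝔍 : Ideal R) :
    taylorShiftRing φk' φr' (𝔍.map (eR : R →+* R')) = (taylorShiftRing φk φr 𝔍).map (eR : R →+* R') := by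
  have hk' : φk'.comp (eR : R →+* R') = (eA : A →+* A').comp φk := RingHom.ext fun x => by
    simpa using hk x
  have hr' : φr'.comp (eA : A →+* A') = (eR : R →+* R').comp φr := RingHom.ext fun a => by
    simpa using hr a
  have h1 : (𝔍.map (eR : R →+* R')).map φk' = (𝔍.map φk).map (eA : A →+* A') := by
    rw [Ideal.map_map, hk', ← Ideal.map_map]
  have h2 : ((𝔍.map φk).map (eA : A →+* A')).map φr' = ((𝔍.map φk).map φr).map (eR : R →+* R') := by
    rw [Ideal.map_map, hr', ← Ideal.map_map]
  rw [taylorShiftRing, taylorShiftRing, h1, h2, ← Ideal.map_sup, ker_eq_map_of_comm φk φk' eR eA hk,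
    ← map_inf_of_ringEquiv, ← map_colon_of_ringEquiv]

include hk hr in
/-- Transport of the iterated shift. [folklore] -/
theorem taylorShiftRingIter_map_of_comm (a : ℕ) :
    ∀ 𝔍 : Ideal R, taylorShiftRingIter φk' φr' a (𝔍.map (eR : R →+* R')) =
      (taylorShiftRingIter φk φr a 𝔍).map (eR : R →+* R') := by
  induction a with
  | zero => intro 𝔍; rfl
  | succ a ih =>
    intro 𝔍
    rw [taylorShiftRingIter_succ, taylorShiftRingIter_succ, taylorShiftRing_map_of_comm φk φr φk' φr' eR eA hk hr, ih]

include hk hr in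
/-- [OURS · L1 W5.2 · lead] **Transport of the ring-level coefficient flag** along ring isomorphisms intertwining the pairs:
`coeffFlagRing φk′ φr′ a (eR 𝔍) = eA (coeffFlagRing φk φr a 𝔍)`. [folklore] -/
theorem coeffFlagRing_map_of_comm (a : ℕ) (𝔍 : Ideal R) :
    coeffFlagRing φk' φr' a (𝔍.map (eR : R →+* R')) = (coeffFlagRing φk φr a 𝔍).map (eA : A →+* A') := by
  have hk' : φk'.comp (eR : R →+* R') = (eA : A →+* A').comp φk := RingHom.ext fun x => by
    simpa using hk x
  rw [coeffFlagRing, coeffFlagRing, taylorShiftRingIter_map_of_comm φk φr φk' φr' eR eA hk hr, Ideal.map_map, hk',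
    ← Ideal.map_map]

end Transport

/-! ### The polynomial pair `(constantCoeff, C)`: the ring-level flag is the family of coefficient ideals -/

section Poly

variable {B : Type u} [CommRing B]

/-- Monotonicity of the coefficient flag in the order. [folklore] -/
theorem coeffIdeal_mono_of_le (𝔎 : Ideal B[X]) {a a' : ℕ} (h : a ≤ a') : coeffIdeal 𝔎 a ≤ coeffIdeal 𝔎 a' :=
  (monotone_nat_of_le_succ fun b => coeffIdeal_mono 𝔎 b) h

/-- The image of an ideal of `B[t]` under `t ↦ 0` is its `0`-th coefficient ideal. [folklore] -/
theorem map_constantCoeff_eq_coeffIdeal (𝔎 : Ideal B[X]) :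
    𝔎.map (Polynomial.constantCoeff : B[X] →+* B) = coeffIdeal 𝔎 0 := by
  ext c
  rw [Ideal.mem_map_iff_of_surjective _ fun b => ⟨Polynomial.C b, by
      rw [Polynomial.constantCoeff_apply, Polynomial.coeff_C_zero]⟩, mem_coeffIdeal_iff]
  simp only [Polynomial.constantCoeff_apply]

/-- [OURS · L1 W5.2 · lead] **The Taylor shift shifts the coefficient flag by one**: for the pair `(constantCoeff, C)` of
`B[t] ⊇ B`, `coeffIdeal (taylorShiftRing 𝔎) b = coeffIdeal 𝔎 (b + 1)` (`⊇`: `(p − p(0))/t`; `⊆`: if `t·h = p + q` with `p ∈ 𝔎` and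
`q ∈ c₀(𝔎)·B[t]` then `coeff_b h = coeff_{b+1} p + coeff_{b+1} q ∈ c_{b+1}(𝔎) + c₀(𝔎) = c_{b+1}(𝔎)`). [cite: KawanoueMatsuki2016, §2] -/
theorem coeffIdeal_taylorShiftRing (𝔎 : Ideal B[X]) (b : ℕ) :
    coeffIdeal (taylorShiftRing (Polynomial.constantCoeff : B[X] →+* B) Polynomial.C 𝔎) b = coeffIdeal 𝔎 (b + 1) := by
  have hker : RingHom.ker (Polynomial.constantCoeff : B[X] →+* B) = Ideal.span {(X : B[X])} :=
    Polynomial.ker_constantCoeff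
  apply le_antisymm
  · intro c hc
    obtain ⟨h, hh, rfl⟩ := mem_coeffIdeal_iff.mp hc
    rw [taylorShiftRing, hker, Ideal.mem_colon_span_singleton, map_constantCoeff_eq_coeffIdeal] at hh
    obtain ⟨hXh, -⟩ := hh
    obtain ⟨p, hp, q, hq, hpq⟩ := Submodule.mem_sup.mp hXh
    have hcoeff : h.coeff b = p.coeff (b + 1) + q.coeff (b + 1) := by
      rw [← Polynomial.coeff_add, hpq, Polynomial.coeff_mul_X]
    rw [hcoeff]
    refine Submodule.add_mem _ (coeff_mem_coeffIdeal hp _) ?_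
    exact coeffIdeal_mono_of_le 𝔎 (Nat.zero_le _) (Ideal.mem_map_C_iff.mp hq (b + 1))
  · intro c hc
    obtain ⟨p, hp, rfl⟩ := mem_coeffIdeal_iff.mp hc
    refine mem_coeffIdeal_iff.mpr ⟨Polynomial.divX p, ?_, Polynomial.coeff_divX⟩
    rw [taylorShiftRing, hker, Ideal.mem_colon_span_singleton, map_constantCoeff_eq_coeffIdeal]
    have hX : Polynomial.divX p * X = p - Polynomial.C (p.coeff 0) :=
      eq_sub_of_add_eq (Polynomial.divX_mul_X_add p)
    refine ⟨?_, Ideal.mul_mem_left _ _ (Ideal.mem_span_singleton_self _)⟩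
    rw [hX]
    exact Submodule.sub_mem _ (Ideal.mem_sup_left hp)
      (Ideal.mem_sup_right (Ideal.mem_map_of_mem _ (coeff_mem_coeffIdeal hp 0)))

/-- The iterated shift shifts the flag by `a`. [folklore] -/
theorem coeffIdeal_taylorShiftRingIter (a : ℕ) :
    ∀ (𝔎 : Ideal B[X]) (b : ℕ),
      coeffIdeal (taylorShiftRingIter (Polynomial.constantCoeff : B[X] →+* B) Polynomial.C a 𝔎) b =
        coeffIdeal 𝔎 (b + a) := by
  induction a with
  | zero => intro 𝔎 b; rfl
  | succ a ih =>
    intro 𝔎 b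
    rw [taylorShiftRingIter_succ, ih, coeffIdeal_taylorShiftRing, Nat.add_assoc]

/-- [OURS · L1 W5.2 · lead] **The ring-level flag of the pair `(constantCoeff, C)` is the family of coefficient ideals**:
`coeffFlagRing constantCoeff C a 𝔎 = coeffIdeal 𝔎 a`. [cite: KawanoueMatsuki2016, §2] -/
theorem coeffFlagRing_eq_coeffIdeal (a : ℕ) (𝔎 : Ideal B[X]) :
    coeffFlagRing (Polynomial.constantCoeff : B[X] →+* B) Polynomial.C a 𝔎 = coeffIdeal 𝔎 a := by
  rw [coeffFlagRing, map_constantCoeff_eq_coeffIdeal, coeffIdeal_taylorShiftRingIter, Nat.zero_add]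

end Poly

end DepthGraded.Taylor

/-! ## §2 Affine retraction pairs: global sections of the abstract flag -/

namespace DepthGraded

open Scheme.IdealSheafData

section Affine

variable {W V : Scheme.{u}} [IsAffine W] [IsAffine V] (k : W ⟶ V) (r : V ⟶ W)

/-- An ideal sheaf on an affine scheme is `ofIdealTop` of its global sections. [folklore] -/
theorem eq_ofIdealTop_ideal_top {X : Scheme.{u}} [IsAffine X] (J : X.IdealSheafData) :
    J = ofIdealTop (J.ideal ⟨⊤, isAffineOpen_top X⟩) :=
  ((equivOfIsAffine (X := X)).symm_apply_apply J).symm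

/-- **Global sections of an inverse image between affine schemes**: `(f^*J)(⊤) = J(⊤)·Γ(X)`. [cite: GortzWedhorn2020, (7.20)] -/
theorem ideal_top_comap {X Y : Scheme.{u}} [IsAffine X] [IsAffine Y] (f : X ⟶ Y) (J : Y.IdealSheafData) :
    (J.comap f).ideal ⟨⊤, isAffineOpen_top X⟩ = (J.ideal ⟨⊤, isAffineOpen_top Y⟩).map f.appTop.hom := by
  conv_lhs => rw [eq_ofIdealTop_ideal_top J, comap_ofIdealTop_of_isAffine]
  exact ideal_ofIdealTop_top _

/-- [OURS · L1 W5.2 · lead] **Global sections of the Taylor shift on an affine retraction pair**: for `V`, `W` affine and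
`ker k.appTop` finitely generated, `(taylorShift k r J)(⊤) = taylorShiftRing k.appTop r.appTop (J(⊤))` (sections of sup / inf /
colon-by-a-finite-type ideal sheaf and of inverse images on affine schemes). [folklore] -/
theorem ideal_top_taylorShift (hk : (RingHom.ker k.appTop.hom).FG) (J : V.IdealSheafData) :
    (taylorShift k r J).ideal ⟨⊤, isAffineOpen_top V⟩ =
      Taylor.taylorShiftRing k.appTop.hom r.appTop.hom (J.ideal ⟨⊤, isAffineOpen_top V⟩) := by
  have hker : k.ker = ofIdealTop (RingHom.ker k.appTop.hom) := Scheme.ker_of_isAffine k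
  have hP : ∀ U : V.affineOpens, (k.ker.ideal U).FG := fun U => by
    rw [hker, ofIdealTop_ideal]
    exact hk.map _
  have htop : k.ker.ideal ⟨⊤, isAffineOpen_top V⟩ = RingHom.ker k.appTop.hom := by
    rw [hker, ideal_ofIdealTop_top]
  rw [taylorShift, ideal_colon_of_fg _ _ hP, Taylor.taylorShiftRing, ← htop]
  simp only [Scheme.IdealSheafData.ideal_inf, Scheme.IdealSheafData.ideal_sup, Pi.inf_apply, Pi.sup_apply]
  rw [ideal_top_comap r, ideal_top_comap k]

/-- Global sections of the iterated Taylor shift. [folklore] -/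
theorem ideal_top_taylorShiftIter (hk : (RingHom.ker k.appTop.hom).FG) (a : ℕ) :
    ∀ J : V.IdealSheafData, (taylorShiftIter k r a J).ideal ⟨⊤, isAffineOpen_top V⟩ =
      Taylor.taylorShiftRingIter k.appTop.hom r.appTop.hom a (J.ideal ⟨⊤, isAffineOpen_top V⟩) := by
  induction a with
  | zero => intro J; rfl
  | succ a ih =>
    intro J
    rw [taylorShiftIter_succ, Taylor.taylorShiftRingIter_succ, ih, ideal_top_taylorShift k r hk]

/-- [OURS · L1 W5.2 · lead] **GLUE G2 — global sections of the abstract coefficient flag on an affine retraction pair**: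
`(coeffFlag k r a J)(⊤) = coeffFlagRing k.appTop r.appTop a (J(⊤))`. [cite: KawanoueMatsuki2016, §2] -/
theorem ideal_top_coeffFlag (hk : (RingHom.ker k.appTop.hom).FG) (a : ℕ) (J : V.IdealSheafData) :
    (coeffFlag k r a J).ideal ⟨⊤, isAffineOpen_top W⟩ =
      Taylor.coeffFlagRing k.appTop.hom r.appTop.hom a (J.ideal ⟨⊤, isAffineOpen_top V⟩) := by
  rw [coeffFlag, ideal_top_comap k, ideal_top_taylorShiftIter k r hk, Taylor.coeffFlagRing]

/-- [OURS · L1 W5.2 · lead] **GLUE G2 on a trivialising chart — the abstract flag IS the family of coefficient ideals.**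
If `Γ(V) ≃ Γ(W)[t]` by a ring isomorphism `e` under which `k.appTop` is `constantCoeff` (`t ↦ 0`, the zero section) and
`r.appTop` is `C` (the projection), then `(coeffFlag k r a J)(⊤) = coeffIdeal (e(J(⊤))) a` for every ideal sheaf `J` on `V` and
every `a`. [cite: KawanoueMatsuki2016, §2] -/
theorem ideal_top_coeffFlag_eq_coeffIdeal (e : Γ(V, ⊤) ≃+* (Γ(W, ⊤))[X])
    (hke : ∀ s : Γ(V, ⊤), k.appTop.hom s = Polynomial.constantCoeff (e s))
    (hre : ∀ b : Γ(W, ⊤), e (r.appTop.hom b) = Polynomial.C b) (a : ℕ) (J : V.IdealSheafData) :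
    (coeffFlag k r a J).ideal ⟨⊤, isAffineOpen_top W⟩ =
      Taylor.coeffIdeal ((J.ideal ⟨⊤, isAffineOpen_top V⟩).map (e : Γ(V, ⊤) →+* (Γ(W, ⊤))[X])) a := by
  -- `ker k.appTop = e⁻¹ (t)` is finitely generated
  have hker : RingHom.ker (Polynomial.constantCoeff : (Γ(W, ⊤))[X] →+* Γ(W, ⊤)) =
      (RingHom.ker k.appTop.hom).map (e : Γ(V, ⊤) →+* (Γ(W, ⊤))[X]) :=
    Taylor.ker_eq_map_of_comm k.appTop.hom Polynomial.constantCoeff e (RingEquiv.refl _) fun s => by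
      rw [RingEquiv.refl_apply, hke]
  have hk : (RingHom.ker k.appTop.hom).FG := by
    have h1 : (RingHom.ker (Polynomial.constantCoeff : (Γ(W, ⊤))[X] →+* Γ(W, ⊤))).FG := by
      rw [Polynomial.ker_constantCoeff]
      exact ⟨{X}, by rw [Finset.coe_singleton]⟩
    rw [hker] at h1
    have h2 := h1.map (e.symm : (Γ(W, ⊤))[X] →+* Γ(V, ⊤))
    rwa [Ideal.map_of_equiv] at h2
  rw [ideal_top_coeffFlag k r hk, ← Taylor.coeffFlagRing_eq_coeffIdeal,
    Taylor.coeffFlagRing_map_of_comm k.appTop.hom r.appTop.hom Polynomial.constantCoeff Polynomial.C e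
      (RingEquiv.refl _) (fun s => by rw [RingEquiv.refl_apply, hke]) (fun b => by rw [RingEquiv.refl_apply, hre]),
    RingEquiv.coe_ringHom_refl, Ideal.map_id]

end Affine

end DepthGraded

end Summit.ResolutionOfSingularities.ResolutionOfSingularities.Theorems

end
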